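import Summits.NavierStokesRegularity.NavierStokesRegularity.Theorems.NoOverheating.Negative.FineRatioWindowsExcluded
import Summits.NavierStokesRegularity.NavierStokesRegularity.Theorems.NoOverheating.Negative.AxisymmetricWindowsExcluded
import Literature.Analysis.FluidPDE.PineauVicolRSS
import Literature.Analysis.FluidPDE.IsometryInvariance

/-!
# KJ-35a — SCREW window sequences: the transport onto Pineau–Vicol's rotated-DSS ansatz
# (route `AngularGalerkinLadder`, crux K2 `NoOverheating`; Pineau–Vicol 2026, (1.13))

Refuter lineage, Negative lane of crux K2 `NoOverheating` (supports, does not decide).  KJ-33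
excluded the UNROTATED fine-ratio stratum (`Rₙ → 1`, `cmax < λ₁(C₀)`, Chae–Wolf) and KJ-34 the
finite-order-torsion strata; here the DSS-rotation of a window profile may be a genuine SCREW
`Rₙ = gₙ R_{θₙ} gₙ⁻¹` about ANY axis.  This file is the rotation-agnostic TRANSPORT; the sequel
`SlowScrewWindowsExcluded` feeds it Pineau–Vicol's Theorem 1.7 (i)
(`pineauVicol2026_rdss_liouville_holds`) and reads the result on K1 ∧ K2.
* `exists_subseq_conj_rotZ_limit` — limits of bounded-angle screws are screws (§1);
* `screw_of_rdss_conj` — conjugating a `(c, g R_θ g⁻¹)`-RDSS field onto the `e₃`-axis (§2);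
* `exists_pvProfile_of_screw`, `profile_eq_zero_of_periodic` — the periodic-profile dictionary
  (1.13) read backwards: a `C²` screw-invariant field on the past IS `pvAnsatz α U` (§3);
* `no_windowSequence_screw_core` — for ANY condition `Q` on the limit screw under which an RDSS
  Liouville CONCLUSION of Pineau–Vicol's form holds with constant `C₀`, no admissible window
  sequence of screws with bounded angles has `Q` at all its subsequential limits (§4).
WHAT THIS IS NOT: not `¬NoOverheating` (vacuous without K1 instances), no new Literature fact, no
definition, standard axioms only.
[cite: PineauVicol2026, Theorem 1.7 and (1.13) (arXiv:2607.09619 p. 7)]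
[cite: BradshawTsai2017CPDE, §1 (arXiv:1610.05680 p. 4)] [cite: ChaeWolf2017RemovingDSS, Thm 1.3] -/

namespace Summit.NavierStokesRegularity.AngularGalerkinLadderScrewWindowsExcluded

open Set Filter MeasureTheory Topology Function
open Literature.Analysis Literature.Analysis.FluidPDE
open Summit.NavierStokesRegularity.FluidComputer
open Summit.NavierStokesRegularity.NavierStokesRegularity.Theses.AngularGalerkinLadder
open Summit.NavierStokesRegularity.AngularGalerkinLadderLadderLimit
open Summit.NavierStokesRegularity.AngularGalerkinLadderFineRatioWindowsExcluded
open Summit.NavierStokesRegularity.AngularGalerkinLadderAxisymmetricWindowsExcluded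

/-! ### §1 Limits of conjugated axis rotations -/

/-- **The limit of slow screws is a screw.**  If isometries `Rₙ → R'` pointwise, each `Rₙ` is the
rotation by `θₙ` about the axis `gₙ e₃` (`Rₙ = gₙ ∘ R_{θₙ} ∘ gₙ⁻¹`, `gₙ` any linear isometry) and
the angles are bounded, then along a subsequence `gₙ → g'`, `θₙ → θ'` and `R' = g' ∘ R_{θ'} ∘ g'⁻¹`
(compactness of the isometry group and of `[−B, B]`; joint continuity of `(θ, y) ↦ R_θ y`).
[folklore] -/
theorem exists_subseq_conj_rotZ_limit
    {R g : ℕ → (EuclideanSpace ℝ (Fin 3) ≃ₗᵢ[ℝ] EuclideanSpace ℝ (Fin 3))} {θ : ℕ → ℝ}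
    {R' : EuclideanSpace ℝ (Fin 3) ≃ₗᵢ[ℝ] EuclideanSpace ℝ (Fin 3)} {B : ℝ}
    (hR : ∀ x, Tendsto (fun n => R n x) atTop (𝓝 (R' x)))
    (hconj : ∀ n x, R n x = g n (rotZ (θ n) ((g n).symm x)))
    (hθB : ∀ n, θ n ∈ Icc (-B) B) :
    ∃ (ψ : ℕ → ℕ) (g' : EuclideanSpace ℝ (Fin 3) ≃ₗᵢ[ℝ] EuclideanSpace ℝ (Fin 3)) (θ' : ℝ),
      StrictMono ψ ∧
      (∀ x, Tendsto (fun n => g (ψ n) x) atTop (𝓝 (g' x))) ∧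
      Tendsto (fun n => θ (ψ n)) atTop (𝓝 θ') ∧ θ' ∈ Icc (-B) B ∧
      ∀ x, R' x = g' (rotZ θ' (g'.symm x)) := by
  obtain ⟨ψ₁, g', hψ₁, -, hg⟩ := exists_subseq_tendsto_linearIsometryEquiv g
  obtain ⟨θ', hθ'mem, ψ₂, hψ₂, hθ⟩ :=
    tendsto_subseq_of_bounded (Metric.isBounded_Icc (-B) B) (x := fun n => θ (ψ₁ n))
      fun n => hθB (ψ₁ n)
  rw [isClosed_Icc.closure_eq] at hθ'mem
  have hgψ : ∀ x, Tendsto (fun n => g (ψ₁ (ψ₂ n)) x) atTop (𝓝 (g' x)) := fun x =>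
    (hg x).comp hψ₂.tendsto_atTop
  refine ⟨ψ₁ ∘ ψ₂, g', θ', hψ₁.comp hψ₂, hgψ, hθ, hθ'mem, fun x => ?_⟩
  have h1 : Tendsto (fun n => (g (ψ₁ (ψ₂ n))).symm x) atTop (𝓝 (g'.symm x)) :=
    tendsto_linearIsometryEquiv_symm_apply hgψ x
  -- `θ ↦ R_θ y` is continuous (coordinates), so `R_{θₙ} → R_{θ'}` pointwise; then the moving point
  have hang : ∀ y : EuclideanSpace ℝ (Fin 3), Continuous fun φ : ℝ => rotZ φ y := fun y => by
    unfold rotZ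
    refine (PiLp.continuous_toLp 2 _).comp (continuous_pi fun i => ?_)
    fin_cases i
    · exact ((Real.continuous_cos.mul (continuous_const (y := y 0))).sub
        (Real.continuous_sin.mul (continuous_const (y := y 1)))).congr fun φ => by simp
    · exact ((Real.continuous_sin.mul (continuous_const (y := y 0))).add
        (Real.continuous_cos.mul (continuous_const (y := y 1)))).congr fun φ => by simp
    · exact (continuous_const (y := y 2)).congr fun φ => by simp
  have hrot : ∀ y, Tendsto (fun n => rotZLIE (θ (ψ₁ (ψ₂ n))) y) atTop (𝓝 (rotZLIE θ' y)) :=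
    fun y => ((hang y).tendsto θ').comp hθ
  have h2 : Tendsto (fun n => rotZ (θ (ψ₁ (ψ₂ n))) ((g (ψ₁ (ψ₂ n))).symm x)) atTop
      (𝓝 (rotZ θ' (g'.symm x))) :=
    tendsto_linearIsometryEquiv_apply_of_tendsto hrot h1
  have h3 : Tendsto (fun n => g (ψ₁ (ψ₂ n)) (rotZ (θ (ψ₁ (ψ₂ n))) ((g (ψ₁ (ψ₂ n))).symm x)))
      atTop (𝓝 (g' (rotZ θ' (g'.symm x)))) :=
    tendsto_linearIsometryEquiv_apply_of_tendsto hgψ h2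
  have h4 : Tendsto (fun n => R (ψ₁ (ψ₂ n)) x) atTop (𝓝 (g' (rotZ θ' (g'.symm x)))) :=
    h3.congr fun n => (hconj _ x).symm
  exact tendsto_nhds_unique ((hR x).comp (hψ₁.comp hψ₂).tendsto_atTop) h4

/-! ### §2 Conjugating a rotated-DSS field onto the `e₃`-axis -/

/-- If `v` is `(c, R)`-rotated-DSS and `R = g ∘ R_θ ∘ g⁻¹`, then the conjugated field
`w(t, x) = g⁻¹ v(t, g x)` is invariant under the screw-dilation about the `e₃`-axis:
`R_{−θ} (c · w(c²t, c R_θ x)) = w(t, x)`.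
[cite: BradshawTsai2017CPDE, §1 (rotated discretely self-similar fields, arXiv:1610.05680 p. 4)] -/
theorem screw_of_rdss_conj {c θ : ℝ}
    {R g : EuclideanSpace ℝ (Fin 3) ≃ₗᵢ[ℝ] EuclideanSpace ℝ (Fin 3)}
    {v : ℝ → EuclideanSpace ℝ (Fin 3) → EuclideanSpace ℝ (Fin 3)} (hv : IsRotatedDSS c R v)
    (hR : ∀ x, R x = g (rotZ θ (g.symm x))) (t : ℝ) (x : EuclideanSpace ℝ (Fin 3)) :
    rotZ (-θ) (c • g.symm (v (c ^ 2 * t) (g (c • rotZ (-(-θ)) x)))) = g.symm (v t (g x)) := by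
  have hRs : ∀ y, R.symm y = g (rotZ (-θ) (g.symm y)) := fun y => by
    apply R.injective
    rw [LinearIsometryEquiv.apply_symm_apply, hR, LinearIsometryEquiv.symm_apply_apply, ← rotZ_add,
      add_neg_cancel, rotZ_zero, LinearIsometryEquiv.apply_symm_apply]
  have key := hv t (g x)
  rw [hR, LinearIsometryEquiv.symm_apply_apply, hRs] at key
  rw [← key]
  simp only [LinearIsometryEquiv.map_smul, LinearIsometryEquiv.symm_apply_apply, neg_neg,
    SereginSverak2009.rotZ_smul_vec]

/-! ### §3 The periodic profile of a screw-invariant field (Pineau–Vicol (1.13) read backwards) -/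

/-- **A smooth field on `t < 0` fixed by the screw-dilation `R_Θ D_c R_{−Θ}` (`c > 1`) is
Pineau–Vicol's rotated discretely self-similar ansatz** `pvAnsatz α U` with angular speed
`α = Θ/(2 log c)` of a `C²` (indeed smooth) profile `U(y, s) = e^{−s/2} R_{−αs} W(−e^{−s},
e^{−s/2} R_{αs} y)`, `2 log c`-periodic in `s` (one period = one application of the screw at
time `−e^{−s}/c²`). [cite: PineauVicol2026, (1.13a)–(1.13b) (arXiv:2607.09619 p. 7)] -/
theorem exists_pvProfile_of_screw {c Θ : ℝ}
    {W : ℝ → EuclideanSpace ℝ (Fin 3) → EuclideanSpace ℝ (Fin 3)} (hc : 1 < c)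
    (hW : ContDiffOn ℝ 2 (uncurry W) (Iio (0 : ℝ) ×ˢ (univ : Set (EuclideanSpace ℝ (Fin 3)))))
    (h : ∀ t : ℝ, t < 0 → ∀ x : EuclideanSpace ℝ (Fin 3),
      rotZ Θ (c • W (c ^ 2 * t) (c • rotZ (-Θ) x)) = W t x) :
    ∃ U : EuclideanSpace ℝ (Fin 3) → ℝ → EuclideanSpace ℝ (Fin 3),
      ContDiff ℝ 2 (fun q : EuclideanSpace ℝ (Fin 3) × ℝ => U q.1 q.2) ∧
      (∀ (y : EuclideanSpace ℝ (Fin 3)) (s : ℝ), U y (s + 2 * Real.log c) = U y s) ∧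
      ∀ t : ℝ, t < 0 → ∀ x : EuclideanSpace ℝ (Fin 3),
        W t x = pvAnsatz (Θ / (2 * Real.log c)) U t x := by
  set α : ℝ := Θ / (2 * Real.log c) with hα
  refine ⟨fun y s => Real.exp (-s / 2) • rotZ (-(α * s))
      (W (-Real.exp (-s)) (Real.exp (-s / 2) • rotZ (α * s) y)), ?_, fun y s => ?_,
    fun t ht x => ?_⟩
  · -- joint smoothness
    have hE : ContDiff ℝ 2 (fun q : EuclideanSpace ℝ (Fin 3) × ℝ => Real.exp (-q.2 / 2)) :=
      Real.contDiff_exp.comp (contDiff_snd.neg.div_const 2)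
    have hθ : ContDiff ℝ 2 (fun q : EuclideanSpace ℝ (Fin 3) × ℝ => α * q.2) :=
      contDiff_const.mul contDiff_snd
    have hT : ContDiff ℝ 2 (fun q : EuclideanSpace ℝ (Fin 3) × ℝ => -Real.exp (-q.2)) :=
      (Real.contDiff_exp.comp contDiff_snd.neg).neg
    -- `q ↦ R_{θ(q)} W(q)` is `C²` when `θ`, `W` are (coordinates of the rotation about `e₃`)
    have hrotgen : ∀ {θf : EuclideanSpace ℝ (Fin 3) × ℝ → ℝ}
        {Wf : EuclideanSpace ℝ (Fin 3) × ℝ → EuclideanSpace ℝ (Fin 3)},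
        ContDiff ℝ 2 θf → ContDiff ℝ 2 Wf → ContDiff ℝ 2 (fun q => rotZ (θf q) (Wf q)) := by
      intro θf Wf hθf hWf
      rw [contDiff_euclidean]
      have hc : ContDiff ℝ 2 (fun q => Real.cos (θf q)) := Real.contDiff_cos.comp hθf
      have hs : ContDiff ℝ 2 (fun q => Real.sin (θf q)) := Real.contDiff_sin.comp hθf
      have hco : ∀ j : Fin 3, ContDiff ℝ 2 (fun q => Wf q j) := fun j =>
        (contDiff_euclidean.1 hWf) j
      intro i
      fin_cases i
      · exact (hc.mul (hco 0)).sub (hs.mul (hco 1))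
      · exact (hs.mul (hco 0)).add (hc.mul (hco 1))
      · exact hco 2
    have hrot : ContDiff ℝ 2 (fun q : EuclideanSpace ℝ (Fin 3) × ℝ => rotZ (α * q.2) q.1) :=
      hrotgen hθ contDiff_fst
    have hin : ContDiff ℝ 2 (fun q : EuclideanSpace ℝ (Fin 3) × ℝ =>
        Real.exp (-q.2 / 2) • rotZ (α * q.2) q.1) := hE.smul hrot
    have hVc : ContDiff ℝ 2 (fun q : EuclideanSpace ℝ (Fin 3) × ℝ =>
        W (-Real.exp (-q.2)) (Real.exp (-q.2 / 2) • rotZ (α * q.2) q.1)) :=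
      hW.comp_contDiff (hT.prodMk hin) fun q => mk_mem_prod (neg_neg_of_pos (Real.exp_pos _))
        (mem_univ _)
    have hrot' : ContDiff ℝ 2 (fun q : EuclideanSpace ℝ (Fin 3) × ℝ => rotZ (-(α * q.2))
        (W (-Real.exp (-q.2)) (Real.exp (-q.2 / 2) • rotZ (α * q.2) q.1))) :=
      hrotgen hθ.neg hVc
    exact hE.smul hrot'
  · -- one period is one application of the screw
    have hc0 : 0 < c := one_pos.trans hc
    have hlog : 0 < Real.log c := Real.log_pos hc
    have hne : 2 * Real.log c ≠ 0 := by positivity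
    have e1 : Real.exp (-(s + 2 * Real.log c) / 2) = Real.exp (-s / 2) * c⁻¹ := by
      rw [show -(s + 2 * Real.log c) / 2 = -s / 2 + -Real.log c by ring, Real.exp_add, Real.exp_neg,
        Real.exp_log hc0]
    have e2 : Real.exp (-(s + 2 * Real.log c)) = Real.exp (-s) * (c ^ 2)⁻¹ := by
      rw [show -(s + 2 * Real.log c) = -s + -(Real.log c + Real.log c) by ring, Real.exp_add,
        Real.exp_neg (Real.log c + Real.log c), Real.exp_add, Real.exp_log hc0, sq]
    have e3 : α * (s + 2 * Real.log c) = α * s + Θ := by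
      rw [mul_add, hα, div_mul_cancel₀ Θ hne]
    show Real.exp (-(s + 2 * Real.log c) / 2) • rotZ (-(α * (s + 2 * Real.log c)))
        (W (-Real.exp (-(s + 2 * Real.log c)))
          (Real.exp (-(s + 2 * Real.log c) / 2) • rotZ (α * (s + 2 * Real.log c)) y)) =
      Real.exp (-s / 2) • rotZ (-(α * s)) (W (-Real.exp (-s)) (Real.exp (-s / 2) • rotZ (α * s) y))
    rw [e1, e2, e3]
    have hτ : -(Real.exp (-s) * (c ^ 2)⁻¹) < 0 := neg_neg_of_pos (by positivity)
    have key := h _ hτ ((Real.exp (-s / 2) * c⁻¹) • rotZ (α * s + Θ) y)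
    have hA : c ^ 2 * -(Real.exp (-s) * (c ^ 2)⁻¹) = -Real.exp (-s) := by field_simp
    have hB : c * (Real.exp (-s / 2) * c⁻¹) = Real.exp (-s / 2) := by field_simp
    have hB' : Real.exp (-s / 2) * c⁻¹ * c = Real.exp (-s / 2) := by field_simp
    have hC : -Θ + (α * s + Θ) = α * s := by ring
    have hD : -(α * s + Θ) + Θ = -(α * s) := by ring
    rw [← key]
    simp only [SereginSverak2009.rotZ_smul_vec, smul_smul, ← rotZ_add]
    rw [hA, hB, hB', hC, hD]
  · -- the ansatz identity (pure algebra: `e^{−s} = −t`, `e^{−s/2} = √(−t)`)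
    have hnt : 0 < -t := neg_pos.2 ht
    have hsq : 0 < Real.sqrt (-t) := Real.sqrt_pos.2 hnt
    have h1 : Real.exp (-(-Real.log (-t)) / 2) = Real.sqrt (-t) := by
      rw [neg_neg, Real.exp_half, Real.exp_log hnt]
    have h2 : -Real.exp (-(-Real.log (-t))) = t := by
      rw [neg_neg, Real.exp_log hnt, neg_neg]
    simp only [pvAnsatz]
    rw [h1, h2, ← rotZ_add, add_neg_cancel, rotZ_zero, smul_smul, mul_inv_cancel₀ hsq.ne', one_smul,
      SereginSverak2009.rotZ_smul_vec, ← rotZ_add, add_neg_cancel, rotZ_zero, smul_smul,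
      inv_mul_cancel₀ hsq.ne', one_smul]

/-- A profile that is `T`-periodic in `s` (`T > 0`) and vanishes on one period vanishes.
[folklore] -/
theorem profile_eq_zero_of_periodic
    {U : EuclideanSpace ℝ (Fin 3) → ℝ → EuclideanSpace ℝ (Fin 3)} {T : ℝ} (hT : 0 < T)
    (hper : ∀ (y : EuclideanSpace ℝ (Fin 3)) (s : ℝ), U y (s + T) = U y s)
    (h0 : ∀ (y : EuclideanSpace ℝ (Fin 3)), ∀ s ∈ Icc (0 : ℝ) T, U y s = 0)
    (y : EuclideanSpace ℝ (Fin 3)) (s : ℝ) : U y s = 0 := by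
  have hp : Function.Periodic (U y) T := fun s => hper y s
  have hmem : toIcoMod hT 0 s ∈ Icc (0 : ℝ) T := by
    have h := toIcoMod_mem_Ico hT 0 s
    rw [zero_add] at h
    exact Ico_subset_Icc_self h
  rw [← hp.sub_zsmul_eq (toIcoDiv hT 0 s), self_sub_toIcoDiv_zsmul]
  exact h0 y _ hmem

/-! ### §4 The transport: a window sequence of screws meeting an RDSS Liouville theorem is empty -/

/-- **Core transport.**  Let `Q θ' c'` be any condition on a limit screw under which the RDSS
Liouville CONCLUSION of Pineau–Vicol's form holds with constant `C₀` (`HL`: a classical solution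
on `[−1, 0)` with the Type-I bound of constant `C₀` which is the ansatz `pvAnsatz (−θ'/(2 log c'))`
of a `C²`, `2 log c'`-periodic profile `U` has `U ≡ 0` on a period).  Then NO admissible window
sequence has screw DSS-rotations `Rₙ = gₙ R_{θₙ} gₙ⁻¹` (any axes) with bounded angles `|θₙ| ≤ B`
and `Q` at every subsequential limit `(θ', c')` of `(θₙ, cₙ)`.  Route: ladder limit
(`exists_ladderLimit_typeI`) → the limit rotation is a screw (`exists_subseq_conj_rotZ_limit`) →
the conjugate `g'⁻¹ v g'` is classical (isometry covariance), Type-I, smooth and screw-fixed about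
`e₃` (`screw_of_rdss_conj`) → it is the ansatz of a smooth periodic profile
(`exists_pvProfile_of_screw`) → `HL` and periodicity kill the profile → `v ≡ 0` on `t < 0`,
against non-triviality of the ladder limit.
[cite: PineauVicol2026, Theorem 1.7 and (1.13) (arXiv:2607.09619 p. 7)] -/
theorem no_windowSequence_screw_core {C₀ : ℝ} (Q : ℝ → ℝ → Prop)
    (HL : ∀ θ' c' : ℝ, Q θ' c' → 1 < c' →
      ∀ (w : ℝ → EuclideanSpace ℝ (Fin 3) → EuclideanSpace ℝ (Fin 3))
        (P : ℝ → EuclideanSpace ℝ (Fin 3) → ℝ)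
        (U : EuclideanSpace ℝ (Fin 3) → ℝ → EuclideanSpace ℝ (Fin 3)),
        IsClassicalNSSolutionOn (Ico (-1) 0) 1 0 w P →
        (∀ t ∈ Ico (-1 : ℝ) 0, ∀ x, ‖w t x‖ ≤ C₀ / (‖x‖ + Real.sqrt (-t))) →
        ContDiff ℝ 2 (fun q : EuclideanSpace ℝ (Fin 3) × ℝ => U q.1 q.2) →
        (∀ y s, U y (s + 2 * Real.log c') = U y s) →
        (∀ t ∈ Ico (-1 : ℝ) 0, ∀ x, w t x = pvAnsatz (-θ' / (2 * Real.log c')) U t x) →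
        ∀ y, ∀ s ∈ Icc (0 : ℝ) (2 * Real.log c'), U y s = 0)
    {cmin cmax δ B : ℝ} {L : ℕ → ℕ} {ε c θ : ℕ → ℝ}
    {R g : ℕ → (EuclideanSpace ℝ (Fin 3) ≃ₗᵢ[ℝ] EuclideanSpace ℝ (Fin 3))}
    {u : ℕ → ℝ → EuclideanSpace ℝ (Fin 3) → EuclideanSpace ℝ (Fin 3)}
    {p : ℕ → ℝ → EuclideanSpace ℝ (Fin 3) → ℝ}
    {d : ℕ → ℝ → EuclideanSpace ℝ (Fin 3) → EuclideanSpace ℝ (Fin 3)}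
    (hcmin : 1 < cmin) (hδ : 0 < δ) (hε : Tendsto ε atTop (𝓝 0))
    (hW : ∀ n, AngularLadder.IsWindowProfile (L n) C₀ cmin cmax δ (ε n) (c n) (R n) (u n) (p n)
      (d n))
    (hconj : ∀ n x, R n x = g n (rotZ (θ n) ((g n).symm x))) (hθB : ∀ n, |θ n| ≤ B)
    (hQ : ∀ (κ : ℕ → ℕ) (θ' c' : ℝ), StrictMono κ → Tendsto (fun n => θ (κ n)) atTop (𝓝 θ') →
      Tendsto (fun n => c (κ n)) atTop (𝓝 c') → Q θ' c') : False := by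
  -- Step 1: the ladder limit (KJ-33a)
  obtain ⟨φ, c', R', v, hφ, -, hclim, hRlim, -, -, -, hc', hTAM, -, hDSS, hTI, -, hnz⟩ :=
    exists_ladderLimit_typeI hcmin hδ hε hW
  -- Step 2: the limit rotation is a screw `g' R_{θ'} g'⁻¹`, and `Q θ' c'`
  obtain ⟨ψ, g', θ', hψ, -, hθlim, -, hR'⟩ :=
    exists_subseq_conj_rotZ_limit (R := fun n => R (φ n)) (g := fun n => g (φ n))
      (θ := fun n => θ (φ n)) hRlim (fun n x => hconj (φ n) x) fun n => abs_le.1 (hθB (φ n))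
  have hQ' : Q θ' c' := hQ (fun n => φ (ψ n)) θ' c' (hφ.comp hψ) hθlim (hclim.comp hψ.tendsto_atTop)
  -- Step 3: conjugate onto the `e₃`-axis: `w = g'⁻¹ v g'` is fixed by `R_{-θ'} D_{c'} R_{θ'}`
  have hscrew : ∀ t : ℝ, t < 0 → ∀ x,
      rotZ (-θ') (c' • (fun t x => g'.symm (v t (g' x))) (c' ^ 2 * t) (c' • rotZ (-(-θ')) x)) =
        (fun t x => g'.symm (v t (g' x))) t x :=
    fun t _ x => screw_of_rdss_conj hDSS hR' t x
  have hwC : ContDiffOn ℝ 2 (uncurry fun t x => g'.symm (v t (g' x)))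
      (Iio (0 : ℝ) ×ˢ (univ : Set (EuclideanSpace ℝ (Fin 3)))) := by
    have e : (uncurry fun t x => g'.symm (v t (g' x))) =
        (fun z : EuclideanSpace ℝ (Fin 3) => g'.symm.toContinuousLinearEquiv z) ∘ uncurry v ∘
          fun q : ℝ × EuclideanSpace ℝ (Fin 3) => (q.1, g'.toContinuousLinearEquiv q.2) := by
      funext q; rfl
    rw [e]
    refine g'.symm.toContinuousLinearEquiv.contDiff.comp_contDiffOn
      ((hTAM.contDiffOn.of_le (WithTop.coe_le_coe.2 le_top)).comp ?_ ?_)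
    · exact (contDiff_fst.prodMk
        (g'.toContinuousLinearEquiv.contDiff.comp contDiff_snd)).contDiffOn
    · intro q hq
      exact ⟨hq.1, mem_univ _⟩
  obtain ⟨U, hU2, hUper, hUans⟩ := exists_pvProfile_of_screw hc' hwC hscrew
  -- Step 4: the conjugate is classical and Type-I on `[-1, 0)`; the Liouville conclusion applies
  obtain ⟨P, hP⟩ := exists_classical_Iio hTAM
  have hPw : IsClassicalNSSolutionOn (Ico (-1 : ℝ) 0) 1 0 (fun t x => g'.symm (v t (g' x)))
      (fun t x => P t (g' x)) := by
    have h1 := (hP.conj_linearIsometryEquiv g'.symm (uniqueDiffOn_Iio 0)).congr_force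
      (g := (0 : ℝ → EuclideanSpace ℝ (Fin 3) → EuclideanSpace ℝ (Fin 3))) (fun t _ x => by simp)
    simp only [LinearIsometryEquiv.symm_symm] at h1
    exact h1.mono Ico_subset_Iio_self (uniqueDiffOn_Ico (-1) 0)
  have hTIw : ∀ t ∈ Ico (-1 : ℝ) 0, ∀ x,
      ‖(fun t x => g'.symm (v t (g' x))) t x‖ ≤ C₀ / (‖x‖ + Real.sqrt (-t)) := by
    intro t ht x
    have h1 := hTI t ht.2 (g' x)
    rw [LinearIsometryEquiv.norm_map] at h1
    show ‖g'.symm (v t (g' x))‖ ≤ _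
    rw [LinearIsometryEquiv.norm_map]
    exact h1
  have hU0 : ∀ y, ∀ s ∈ Icc (0 : ℝ) (2 * Real.log c'), U y s = 0 :=
    HL θ' c' hQ' hc' _ _ U hPw hTIw hU2 hUper (fun t ht x => hUans t ht.2 x)
  -- Step 5: `U ≡ 0`, so `w ≡ 0` and `v ≡ 0` on `t < 0`
  have hU00 : ∀ y s, U y s = 0 :=
    profile_eq_zero_of_periodic (mul_pos two_pos (Real.log_pos hc')) hUper hU0
  have hz : ∀ a : ℝ, rotZ a (0 : EuclideanSpace ℝ (Fin 3)) = 0 := fun a => (rotZLIE a).map_zero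
  have hv0 : ∀ t < 0, ∀ y, v t y = 0 := fun t ht y => by
    have h1 := hUans t ht (g'.symm y)
    simp only [pvAnsatz, hU00, hz, smul_zero, LinearIsometryEquiv.apply_symm_apply] at h1
    simpa using congrArg g' h1
  exact hnz fun t ht => Eventually.of_forall (hv0 t ht)

end Summit.NavierStokesRegularity.AngularGalerkinLadderScrewWindowsExcluded
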